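import Literature.AlgebraicGeometry.GroupSchemes.AdmissibleIdealSpecialFibreSurjective   -- ★ `finrank_quotient_le_natCard_sections` (+ ★ `EtaleIdealEqPointsIdeal`)
import HarnessLib

/-!
# Crux `HLiu418` — P6 sub-line **F0-P6a**, L3 socket `stub_FROB` ∕ `stub_ROOF0`: THE CANONICAL-LINE TRANSFER (G-sp)
# (the roof at the abstract-canonical line `L` IS the roof at the geometric-canonical line `L_geo`: `red₀ (quotΩ y L) = red₀ (quotΩ y L_geo)`)

Cell `hodgecm-mathlib`, crux `stmt-HodgeConjecture-24832` (hLiu418), sub-line P6a, «L3» organ **(G-sp) «CANONICAL-LINE TRANSFER»** (LA3-plan (g0)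
«Q-ROOF-sp» finding + DEAL 2026-09-02T02:4xZ → A-p03 (g31); `--supports stmt-HodgeConjecture-24832`, count-neutral).  THEOREMS ONLY (no definition,
no instance, no notation, no named fact, no `sorry`).  HC_CM is proved only modulo the printed citations (2 remaining named inputs hLiu418 24832,
h413 24833) until rung 0 closes; nothing here is about HC.

THE FINDING (LA3-plan).  The D-line socket `stub_ROOF0` (`Cruxes/HLiu418/Lines/F0_P6a_DatumOfInputs.lean`, `Quot₀RoofLaw` :360) serves a roof at
`(red₀ y, red₀ (quotΩ y L))` for EVERY reading `𝔯 : DownReadings …` and every line `L` with `𝔯.spec.sp y L = kerFOf …` — an ABSTRACT canonicity, while the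
ROOF road (LA3-p01) builds the roof at the GEOMETRIC canonical line (the line whose closure special fibre is the Frobenius kernel, L2's `spGeoOf`).  The two
target points coincide.  WHY ([Liu2021] Prop. D.8 (3), pp. 137–138; [Carayol1986Compositio] §10.3; [Tate1997FiniteFlatGroupSchemes] (3.7); [Hirschfeld1998]
Thm. 3.1.1): at a point whose `w`-block has an étale admissible subgroup («ordinary»), the admissible subgroups are `{kerF, H_ét}` — the DICHOTOMY «Frobenius
kernel or étale» (★ (K-b) `eq_kerFI_or_idealIsEtale_of_isAdm`) plus the UNIQUENESS of the étale admissible ideal (★ `eq_of_etale_of_finrank_eq_natCard_sections`: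
an étale ideal of corank `#G(k̄)` is the ideal of all points; §2 here feeds it from the dock row `#G(k̄) ∈ {1, q}`); each specialisation reading (`sp`, `spGeo`)
has exactly ONE line over `kerF` (the canonical line (b4′)); the `q + 1 ≥ 3` lines over `y` (★ `IdealTorsionStableSubgroups`) supply a third line `L₂`
canonical for NEITHER reading, hence read `H_ét` by BOTH; each reading's quotient point depends only on the reading (`red_quotΩ` for `sp`, L2's SP4
well-definedness for `spGeo`); so `red₀ (quotΩ y L_geo) = red₀ (quotΩ y L₂) = red₀ (quotΩ y L)`.  At a point with NO étale admissible subgroup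
(«supersingular») every admissible subgroup is `kerF` and `L_geo := L` serves.

MAIN STATEMENTS.  §1 (frame-free, abstract carriers — the D-line instantiates `red := red₀Of …`, `Line := LineOf I`, `Sub := SubOf I 𝔡`,
`kerF := kerFOf I 𝔡`, `IsEtale := IsEtaleOf I 𝔡`, `sp := 𝔯.spec.sp`, `spGeo := spGeoOf I 𝔡`, `hcan₁ := 𝔯.spec.canonicalLine₀`, `hwd₁` from
`𝔯.spec.red_quotΩ` by `canonicalLine_transfer_of_red_quotΩ`): **`canonicalLine_transfer`** — for two readings `sp₁ sp₂` with the canonical-line law, quotient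
points depending only on the reading, the dichotomy, étale uniqueness and a third line:
`sp₁ y L = kerF (red y) → ∃ L′, sp₂ y L′ = kerF (red y) ∧ red (quotΩ y L′) = red (quotΩ y L)`; **`canonicalLine_transfer_of_red_quotΩ`** (the `red_quotΩ`
form of `hwd₁`); `exists_ne_ne_of_natCard_eq` (the third line from `#Line y = q + 1`, `2 ≤ q`).  §2 (generic, `k` separably closed, `G` finite affine over
`k`): **`eq_of_etale_of_finrank_eq_of_natCard_sections_eq_one_or`** — two ideals with étale quotients of the same corank `r ≥ 2` coincide as soon as
`#G(k) ∈ {1, r}` (the dock row `hpts₀`): the `hEt` input of §1 at `Sub := AdmSub (G₀ x̄) (β₀ x̄) q`.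

[cite: Liu2021, Prop. D.8 (3) p. 135, pp. 137–138] [cite: Carayol1986Compositio, §10.3 Prop. p. 211] [cite: Tate1997FiniteFlatGroupSchemes, (3.7)]
[cite: Hirschfeld1998, §3.1 (Thm. 3.1.1)] [cite: StacksProject, Tag 00U3]
-/

set_option autoImplicit false

-- `Summit.HodgeConjecture.HodgeConjecture.…` repeats `HodgeConjecture` by design (D-0017).
set_option linter.dupNamespace false

noncomputable section

namespace Summit.HodgeConjecture.HodgeConjecture.Theorems.F0P6aCanonicalLineTransfer

universe u u₁ u₂ u₃ u₄

/-! ### §1 The transfer, frame-free -/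

section FrameFree

variable {Ω : Type u₁} {P : Type u₂} (red : Ω → P) (Line : Ω → Type u₃) (Sub : P → Type u₄)
  (kerF : ∀ x, Sub x) (IsEtale : ∀ {x : P}, Sub x → Prop) (quotΩ : ∀ y, Line y → Ω)
  (sp₁ sp₂ : ∀ y, Line y → Sub (red y))

/-- **THE CANONICAL-LINE TRANSFER (frame-free).**  Two specialisation readings `sp₁, sp₂ : Line y → Sub (red y)` of the lines at `y`, each with
the CANONICAL-LINE law (at a point with an étale admissible subgroup exactly one line reads `kerF`: `hcan₁`, `hcan₂`) and each DETERMINING the reduction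
of the moduli quotient (`hwd₁`, `hwd₂`); the admissible subgroups obey the DICHOTOMY «`kerF` or étale» (`hdich`) with the étale one UNIQUE (`hEt`); and
over `y` there is a line different from any two given ones (`hthree`, `q + 1 ≥ 3`).  THEN a line canonical for `sp₁` has an `sp₂`-canonical partner
with the SAME quotient reduction: `sp₁ y L = kerF (red y) → ∃ L′, sp₂ y L′ = kerF (red y) ∧ red (quotΩ y L′) = red (quotΩ y L)`.
Ordinary case through a third line read étale by both readings; supersingular case `L′ := L`.
[cite: Liu2021, Prop. D.8 (3) p. 135, pp. 137–138] [cite: Carayol1986Compositio, §10.3 Prop. p. 211] [cite: Tate1997FiniteFlatGroupSchemes, (3.7)]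
[cite: Hirschfeld1998, §3.1 (Thm. 3.1.1)] -/
theorem canonicalLine_transfer
    (hdich : ∀ x (H : Sub x), H = kerF x ∨ IsEtale H)
    (hEt : ∀ x (H H' : Sub x), IsEtale H → IsEtale H' → H = H')
    (hcan₁ : ∀ y, (∃ H : Sub (red y), IsEtale H) →
      ∃ L₀ : Line y, sp₁ y L₀ = kerF (red y) ∧ ∀ L : Line y, sp₁ y L = kerF (red y) → L = L₀)
    (hcan₂ : ∀ y, (∃ H : Sub (red y), IsEtale H) →
      ∃ L₀ : Line y, sp₂ y L₀ = kerF (red y) ∧ ∀ L : Line y, sp₂ y L = kerF (red y) → L = L₀)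
    (hwd₁ : ∀ y (L L' : Line y), sp₁ y L = sp₁ y L' → red (quotΩ y L) = red (quotΩ y L'))
    (hwd₂ : ∀ y (L L' : Line y), sp₂ y L = sp₂ y L' → red (quotΩ y L) = red (quotΩ y L'))
    (hthree : ∀ y (L L' : Line y), ∃ L'' : Line y, L'' ≠ L ∧ L'' ≠ L')
    (y : Ω) (L : Line y) (hL : sp₁ y L = kerF (red y)) :
    ∃ L' : Line y, sp₂ y L' = kerF (red y) ∧ red (quotΩ y L') = red (quotΩ y L) := by
  classical
  by_cases hord : ∃ H : Sub (red y), IsEtale H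
  · -- ordinary: the `sp₂`-canonical line `L₀`
    obtain ⟨L₀, hL₀, huniq₂⟩ := hcan₂ y hord
    obtain ⟨L₁, hL₁, huniq₁⟩ := hcan₁ y hord
    have hLL₁ : L = L₁ := huniq₁ L hL
    refine ⟨L₀, hL₀, ?_⟩
    by_cases hLL₀ : L₀ = L
    · rw [hLL₀]
    · -- a third line, canonical for neither reading
      obtain ⟨L₂, h₂L, h₂L₀⟩ := hthree y L L₀
      -- every non-canonical line reads the (unique) étale subgroup
      have et₁ : ∀ M : Line y, M ≠ L → IsEtale (sp₁ y M) := fun M hM =>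
        (hdich _ (sp₁ y M)).resolve_left fun h => hM ((huniq₁ M h).trans hLL₁.symm)
      have et₂ : ∀ M : Line y, M ≠ L₀ → IsEtale (sp₂ y M) := fun M hM =>
        (hdich _ (sp₂ y M)).resolve_left fun h => hM (huniq₂ M h)
      have e₁ : sp₁ y L₀ = sp₁ y L₂ := hEt _ _ _ (et₁ L₀ hLL₀) (et₁ L₂ h₂L)
      have e₂ : sp₂ y L₂ = sp₂ y L := hEt _ _ _ (et₂ L₂ h₂L₀) (et₂ L (Ne.symm hLL₀))
      exact (hwd₁ y L₀ L₂ e₁).trans (hwd₂ y L₂ L e₂)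
  · -- supersingular: every admissible subgroup is `kerF`
    exact ⟨L, (hdich _ (sp₂ y L)).resolve_right fun h => hord ⟨_, h⟩, rfl⟩

/-- **The transfer with `hwd₁` in `red_quotΩ` form** (the D-line's `SpecReadings.red_quotΩ`: `red (quotΩ y L) = quot₀ (red y) (sp₁ y L)`, so the
quotient reduction depends only on `sp₁ y L`).  Same conclusion as `canonicalLine_transfer`. [cite: Liu2021, Prop. D.8 (3) p. 135, pp. 137–138]
[cite: Carayol1986Compositio, §10.3 Prop. p. 211] -/
theorem canonicalLine_transfer_of_red_quotΩ (quot₀ : ∀ x, Sub x → P)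
    (hred_quotΩ : ∀ y (L : Line y), red (quotΩ y L) = quot₀ (red y) (sp₁ y L))
    (hdich : ∀ x (H : Sub x), H = kerF x ∨ IsEtale H)
    (hEt : ∀ x (H H' : Sub x), IsEtale H → IsEtale H' → H = H')
    (hcan₁ : ∀ y, (∃ H : Sub (red y), IsEtale H) →
      ∃ L₀ : Line y, sp₁ y L₀ = kerF (red y) ∧ ∀ L : Line y, sp₁ y L = kerF (red y) → L = L₀)
    (hcan₂ : ∀ y, (∃ H : Sub (red y), IsEtale H) →
      ∃ L₀ : Line y, sp₂ y L₀ = kerF (red y) ∧ ∀ L : Line y, sp₂ y L = kerF (red y) → L = L₀)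
    (hwd₂ : ∀ y (L L' : Line y), sp₂ y L = sp₂ y L' → red (quotΩ y L) = red (quotΩ y L'))
    (hthree : ∀ y (L L' : Line y), ∃ L'' : Line y, L'' ≠ L ∧ L'' ≠ L')
    (y : Ω) (L : Line y) (hL : sp₁ y L = kerF (red y)) :
    ∃ L' : Line y, sp₂ y L' = kerF (red y) ∧ red (quotΩ y L') = red (quotΩ y L) :=
  canonicalLine_transfer red Line Sub kerF IsEtale quotΩ sp₁ sp₂ hdich hEt hcan₁ hcan₂
    (fun y L L' h => by rw [hred_quotΩ, hred_quotΩ, h]) hwd₂ hthree y L hL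

/-- **A third element**: in a type of cardinality `n ≥ 3` (the `q + 1` lines over `y`, `q = p^f ≥ 2`: ★ `IdealTorsionStableSubgroups.natCard_stableSubgroups_eq_succ`)
there is an element different from any two given ones — the `hthree` input of `canonicalLine_transfer`. [cite: Hirschfeld1998, §3.1 (Thm. 3.1.1)] -/
theorem exists_ne_ne_of_natCard_eq {X : Type u₃} {n : ℕ} (hX : Nat.card X = n) (hn : 3 ≤ n) (a b : X) : ∃ c : X, c ≠ a ∧ c ≠ b := by
  classical
  by_contra h
  push Not at h
  have hsurj : Function.Surjective (fun i : Bool => if i then a else b) := fun c => by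
    by_cases hca : c = a
    · exact ⟨true, by simp [hca]⟩
    · exact ⟨false, by simp [h c hca]⟩
  have hle : Nat.card X ≤ Nat.card Bool := Nat.card_le_card_of_surjective _ hsurj
  simp only [Nat.card_eq_fintype_card, Fintype.card_bool] at hle
  omega

/-- The `hthree` input of `canonicalLine_transfer` from the line count `#Line y = q + 1` with `2 ≤ q`. [cite: Hirschfeld1998, §3.1 (Thm. 3.1.1)] -/
theorem exists_ne_ne_of_natCard_eq_succ {q : ℕ} (hq : 2 ≤ q) (hcard : ∀ y, Nat.card (Line y) = q + 1) (y : Ω) (L L' : Line y) :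
    ∃ L'' : Line y, L'' ≠ L ∧ L'' ≠ L' :=
  exists_ne_ne_of_natCard_eq (hcard y) (by omega) L L'

end FrameFree

/-! ### §2 The étale admissible ideal is unique (the `hEt` input, generic over a finite affine group scheme with `#G(k) ∈ {1, r}`) -/

section EtaleUnique

open CategoryTheory AlgebraicGeometry MonoidalCategory
open Literature.AlgebraicGeometry.Motives Literature.AlgebraicGeometry.GroupSchemes
open Literature.AlgebraicGeometry.GroupSchemes.AffineGroupScheme

variable {k : Type u} [Field k] [IsSepClosed k] (G : SchemeOver k) [IsAffine G.left] [IsFinite G.hom]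

/-- **UNIQUENESS OF THE ÉTALE IDEAL OF CORANK `r` WHEN `#G(k) ∈ {1, r}`, `r ≥ 2`** (the dock row `hpts₀ : #G₀(k̄) = 1 ∨ #G₀(k̄) = q` of the `w`-block):
an ideal `I ⊂ Γ(G)` with `Spec (Γ(G) ⧸ I) → Spec k` étale of corank `r` forces `r ≤ #G(k)` (★ `finrank_quotient_le_natCard_sections`: its `r` points are points
of `G`), so `#G(k) = r` and `I` is the ideal of ALL points (★ `eq_of_etale_of_finrank_eq_natCard_sections`) — two such ideals coincide.  In the P6 HEART: at an
ordinary reduction the `w`-block has exactly ONE étale admissible subgroup `H_ét`. [cite: Tate1997FiniteFlatGroupSchemes, (3.7)] [cite: StacksProject, Tag 00U3] -/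
theorem eq_of_etale_of_finrank_eq_of_natCard_sections_eq_one_or {r : ℕ} (hr : 2 ≤ r)
    (hpts : Nat.card (𝟙_ (SchemeOver k) ⟶ G) = 1 ∨ Nat.card (𝟙_ (SchemeOver k) ⟶ G) = r)
    (I₁ I₂ : Ideal (Alg G)) (h₁ : Etale (specOver k (Alg G ⧸ I₁)).hom) (h₂ : Etale (specOver k (Alg G ⧸ I₂)).hom)
    (hc₁ : Module.finrank k (Alg G ⧸ I₁) = r) (hc₂ : Module.finrank k (Alg G ⧸ I₂) = r) : I₁ = I₂ := by
  have hle : r ≤ Nat.card (𝟙_ (SchemeOver k) ⟶ G) := hc₁ ▸ AdmSpecialFibreSurj.finrank_quotient_le_natCard_sections G I₁ h₁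
  have hcard : Nat.card (𝟙_ (SchemeOver k) ⟶ G) = r := hpts.resolve_left fun h1 => by omega
  exact EtaleIdealPoints.eq_of_etale_of_finrank_eq_natCard_sections G I₁ I₂ h₁ h₂ (hc₁.trans hcard.symm) (hc₂.trans hcard.symm)

/-- **The same on a SUBTYPE of ideals** (the carriers `Sub x̄ := AdmSub (G₀ x̄) (β₀ x̄) q = {I // IsAdm …}` of the D-line, whose admissibility clause
CONTAINS `Module.finrank k (Alg G ⧸ I) = q`): two members with étale quotients are equal. [cite: Tate1997FiniteFlatGroupSchemes, (3.7)] [cite: StacksProject, Tag 00U3] -/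
theorem subtype_eq_of_etale_of_natCard_sections_eq_one_or {r : ℕ} (hr : 2 ≤ r)
    (hpts : Nat.card (𝟙_ (SchemeOver k) ⟶ G) = 1 ∨ Nat.card (𝟙_ (SchemeOver k) ⟶ G) = r)
    {p : Ideal (Alg G) → Prop} (hp : ∀ I, p I → Module.finrank k (Alg G ⧸ I) = r)
    (H H' : {I : Ideal (Alg G) // p I}) (h : Etale (specOver k (Alg G ⧸ H.1)).hom) (h' : Etale (specOver k (Alg G ⧸ H'.1)).hom) : H = H' :=
  Subtype.ext (eq_of_etale_of_finrank_eq_of_natCard_sections_eq_one_or G hr hpts H.1 H'.1 h h' (hp _ H.2) (hp _ H'.2))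

end EtaleUnique

end Summit.HodgeConjecture.HodgeConjecture.Theorems.F0P6aCanonicalLineTransfer

end
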